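import Literature.NumberTheory.Sieve.QuadraticRootsPrimeModuliDFISievePartition
import HarnessLib

/-!
# Duke–Friedlander–Iwaniec 1995, §6: the range `w ≤ q < y` of the double Buchstab sum (Lemmas 1–3)

Topic `Literature/NumberTheory/Sieve`.  Fourth layer towards the discharge of
`Literature.NumberTheory.Sieve.dukeFriedlanderIwaniec1995_theorem5` (W. Duke, J. B. Friedlander,
H. Iwaniec, Ann. of Math. 141 (1995), §6 pp. 434–437), continuing `…DFISievePartition` (the points
`y_k`, the partition of `[w, y)`, the crude bounds for `S(C_{pq}, ·)`, `S(C_{pqr}, ·)` and the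
identification of one fibre of the middle piece with a general bilinear form (33)).  Here the pieces
are summed over `q`:

* `DFI1995.norm_doubleSum_middle_le` — for `|c_n| ≤ τ(n)`, `2 ≤ w < y ≤ z ≤ x`, `K ≥ 1` and
  `|R(w, y)| ≤ B₂` for every admissible general bilinear form (hypothesis (35) at this `x`):
  `|∑_{w ≤ q < y} ∑_{q < p < z} S(C_{pq}, q)| ≤ X Δ₀ G (4 + 8G) + K B₂` with `X = x(1 + log x)`,
  `Δ₀ = 1/w + log(y/w)/K`, `G = log log x + 4` — the partition into `[y_{k+1}, y_k)`, the split of `p`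
  at `y_k`, Buchstab once more for `p ≥ y_k` (`S(C_{pq}, q) = S(C_{pq}, y_k) + ∑_{q ≤ r < y_k} S(C_{pqr}, r)`),
  the crude bound (27) for the two extreme pieces (the paper's `Δ X G(z)²` in (31)) and (35) fibre by
  fibre for the middle piece (the paper's `∑_{0≤k<K} ∑∑ S(C_{pq}, y_k)`, `K` forms);
* `DFI1995.norm_doubleSum_sub_le` — the same for the full double sum minus its part `y ≤ q < z`
  (which Lemma 3 / Theorem 5 leave alone).

Everything here is proved.

## References

* W. Duke, J. B. Friedlander, H. Iwaniec, Ann. of Math. (2) 141 (1995), 423–441, §6 pp. 434–437,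
  Lemma 1 (26), (27), (30), Lemma 2 (31), (33), (35). [cite: DukeFriedlanderIwaniec1995, §6 Lemmas 1–3]
-/

namespace Literature.NumberTheory.Sieve

open scoped BigOperators
open Finset Real

namespace DFI1995

noncomputable section

/-! ### The range `w ≤ q < y` of the double sum -/

/-- Splitting `primesIco w z` at `y` (`w ≤ y ≤ z`). [folklore] -/
theorem sum_primesIco_split {N : Type*} [AddCommMonoid N] {w y z : ℝ} (hwy : w ≤ y) (hyz : y ≤ z)
    (F : ℕ → N) :
    ∑ q ∈ primesIco w z, F q = ∑ q ∈ primesIco w y, F q + ∑ q ∈ primesIco y z, F q := by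
  rw [← Finset.sum_filter_add_sum_filter_not (primesIco w z) (fun q : ℕ => (q : ℝ) < y)]
  congr 1
  · congr 1
    ext q
    simp only [Finset.mem_filter, mem_primesIco]
    constructor
    · rintro ⟨⟨hq, hwq, -⟩, hqy⟩; exact ⟨hq, hwq, hqy⟩
    · rintro ⟨hq, hwq, hqy⟩; exact ⟨⟨hq, hwq, hqy.trans_le hyz⟩, hqy⟩
  · congr 1
    ext q
    simp only [Finset.mem_filter, mem_primesIco, not_lt]
    constructor
    · rintro ⟨⟨hq, -, hqz⟩, hqy⟩; exact ⟨hq, hqy, hqz⟩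
    · rintro ⟨hq, hqy, hqz⟩; exact ⟨⟨hq, hwy.trans hqy, hqz⟩, hqy⟩

/-- **The bilinear part of Lemmas 1–3** (pp. 434–437).  Let `|c_n| ≤ τ(n)`, `2 ≤ w < y ≤ z ≤ x`,
`K ≥ 1`, and suppose every general bilinear form (33) `R(w, y)` with `|α_m| ≤ ω(m)`, `|β_n| ≤ 1`,
`β` on primes has `|R(w, y)| ≤ B₂` (hypothesis (35) at this `x`).  Then the part `w ≤ q < y` of
the double Buchstab sum satisfies
`|∑_{w ≤ q < y} ∑_{q < p < z} S(C_{pq}, q)| ≤ X Δ₀ G (4 + 8G) + K B₂`,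
`X = x(1 + log x)`, `Δ₀ = 1/w + log(y/w)/K`, `G = log log x + 4`: the partition into `[y_{k+1}, y_k)`,
the split of `p` at `y_k`, Buchstab once more for `p ≥ y_k`, the crude bound (27) for the two
extreme pieces (the paper's `Δ X G(z)²` term of (31)) and (35) fibre by fibre for the middle piece
(the paper's `∑_{0≤k<K} ∑∑_{y_{k+1} ≤ p < y_k ≤ q < z} S(C_{pq}, y_k)`, `K` forms).
[cite: DukeFriedlanderIwaniec1995, §6 Lemma 1 (26), Lemma 2 (31), Lemma 3] -/
theorem norm_doubleSum_middle_le {c : ℕ → ℂ} (hc : ∀ n : ℕ, 1 ≤ n → ‖c n‖ ≤ (Nat.divisors n).card)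
    {x w y z : ℝ} {K : ℕ} (hw : 2 ≤ w) (hwy : w < y) (hyz : y ≤ z) (hzx : z ≤ x) (hK : 0 < K) {B₂ : ℝ}
    (hB : ∀ α β : ℕ → ℂ, (∀ m : ℕ, ‖α m‖ ≤ ArithmeticFunction.cardDistinctFactors m) →
      (∀ n : ℕ, ‖β n‖ ≤ 1) → (∀ n : ℕ, ¬ n.Prime → β n = 0) → ‖sieveR₂ c α β x w y‖ ≤ B₂) :
    ‖∑ q ∈ primesIco w y, ∑ p ∈ (primesIco w z).filter (fun p : ℕ => q < p), siftedQ c x (p * q) q‖ ≤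
      (x * (1 + Real.log x)) * (w⁻¹ + Real.log (y / w) / K) * (Real.log (Real.log x) + 4) *
          (4 + 8 * (Real.log (Real.log x) + 4)) + K * B₂ := by
  classical
  have hw0 : 0 < w := by linarith
  have hw1 : 1 ≤ w := by linarith
  have hy : 0 < y := by linarith
  have hx2 : 2 ≤ x := by linarith
  have hx1 : 1 ≤ x := by linarith
  set X : ℝ := x * (1 + Real.log x) with hX
  set Δ₀ : ℝ := w⁻¹ + Real.log (y / w) / K with hΔ₀
  set G : ℝ := Real.log (Real.log x) + 4 with hG
  have hX0 : 0 ≤ X := by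
    have := Real.log_nonneg hx1; positivity
  have hΔ₀0 : 0 ≤ Δ₀ := by
    have : 0 ≤ Real.log (y / w) := Real.log_nonneg ((one_le_div hw0).2 hwy.le)
    positivity
  -- `G` bounds every sum of `1/p` over primes `≤ x`
  have hGbound : ∀ S : Finset ℕ, (∀ p ∈ S, p.Prime ∧ (p : ℝ) ≤ x) → ∑ p ∈ S, (p : ℝ)⁻¹ ≤ G :=
    fun S hS => sum_inv_primes_le_loglog hx2 hS
  have hG0 : 0 ≤ G := le_trans (by simp) (hGbound ∅ (by simp))
  -- the partition index
  have hex : ∀ q ∈ primesIco w y, ∃ k : ℕ, k < K ∧ (y * Real.exp (-(((k + 1 : ℕ) : ℝ) * (Real.log (y / w) / (K : ℝ))))) ≤ (q : ℝ) ∧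
      (q : ℝ) < (y * Real.exp (-((k : ℝ) * (Real.log (y / w) / (K : ℝ))))) := by
    intro q hq
    obtain ⟨-, hwq, hqy⟩ := mem_primesIco.1 hq
    exact exists_partition_index hw0 hwy hK hwq hqy
  choose! kf hkf using hex
  -- the three pieces, for each `q`
  set A : ℕ → ℂ := fun q => ∑ p ∈ ((primesIco w z).filter (fun p : ℕ => q < p)).filter
      (fun p : ℕ => (p : ℝ) < (y * Real.exp (-((kf q : ℝ) * (Real.log (y / w) / (K : ℝ)))))), siftedQ c x (p * q) q with hA
  set B : ℕ → ℂ := fun q => ∑ p ∈ primesIco ((y * Real.exp (-((kf q : ℝ) * (Real.log (y / w) / (K : ℝ)))))) z,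
      siftedQ c x (p * q) ((y * Real.exp (-((kf q : ℝ) * (Real.log (y / w) / (K : ℝ)))))) with hBdef
  set C : ℕ → ℂ := fun q => ∑ p ∈ primesIco ((y * Real.exp (-((kf q : ℝ) * (Real.log (y / w) / (K : ℝ)))))) z,
      ∑ r ∈ primesIco q ((y * Real.exp (-((kf q : ℝ) * (Real.log (y / w) / (K : ℝ)))))), siftedQ c x (p * q * r) r with hC
  have hdecomp : ∀ q ∈ primesIco w y,
      ∑ p ∈ (primesIco w z).filter (fun p : ℕ => q < p), siftedQ c x (p * q) q = A q + B q + C q := by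
    intro q hq
    obtain ⟨hk, hq1, hq2⟩ := hkf q hq
    obtain ⟨hqp, hwq, hqy⟩ := mem_primesIco.1 hq
    set u := (y * Real.exp (-((kf q : ℝ) * (Real.log (y / w) / (K : ℝ))))) with hu
    have hwu : w ≤ u := le_yk hy hw0 hwy.le hK hk.le
    rw [← Finset.sum_filter_add_sum_filter_not ((primesIco w z).filter (fun p : ℕ => q < p))
      (fun p : ℕ => (p : ℝ) < u)]
    have hset : ((primesIco w z).filter (fun p : ℕ => q < p)).filter (fun p : ℕ => ¬ (p : ℝ) < u) =
        primesIco u z := by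
      ext p
      simp only [Finset.mem_filter, mem_primesIco, not_lt]
      constructor
      · rintro ⟨⟨⟨hp, -, hpz⟩, -⟩, hup⟩; exact ⟨hp, hup, hpz⟩
      · rintro ⟨hp, hup, hpz⟩
        exact ⟨⟨⟨hp, hwu.trans hup, hpz⟩, by exact_mod_cast hq2.trans_le hup⟩, hup⟩
    rw [hset, add_assoc]
    congr 1
    rw [hBdef, hC]
    dsimp only
    rw [← Finset.sum_add_distrib]
    refine Finset.sum_congr rfl fun p _ => ?_
    have h := siftedQ_buchstab c x (p * q) hq2.le
    rw [h]; abel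
  rw [Finset.sum_congr rfl hdecomp, Finset.sum_add_distrib, Finset.sum_add_distrib]
  -- (A)
  have hAq : ∀ q ∈ primesIco w y, ‖A q‖ ≤ 4 * X * Δ₀ * (q : ℝ)⁻¹ := by
    intro q hq
    obtain ⟨hk, hq1, hq2⟩ := hkf q hq
    obtain ⟨hqp, hwq, hqy⟩ := mem_primesIco.1 hq
    rw [hA]
    dsimp only
    refine (norm_sum_le _ _).trans ?_
    have hshort : ∑ p ∈ ((primesIco w z).filter (fun p : ℕ => q < p)).filter
        (fun p : ℕ => (p : ℝ) < (y * Real.exp (-((kf q : ℝ) * (Real.log (y / w) / (K : ℝ)))))), (p : ℝ)⁻¹ ≤ Δ₀ := by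
      refine sum_inv_short_le hw1 hwy.le hK hk fun p hp => ?_
      simp only [Finset.mem_filter] at hp
      exact ⟨hq1.trans (by exact_mod_cast hp.1.2.le), hp.2⟩
    calc ∑ p ∈ ((primesIco w z).filter (fun p : ℕ => q < p)).filter
          (fun p : ℕ => (p : ℝ) < (y * Real.exp (-((kf q : ℝ) * (Real.log (y / w) / (K : ℝ)))))), ‖siftedQ c x (p * q) q‖
        ≤ ∑ p ∈ ((primesIco w z).filter (fun p : ℕ => q < p)).filter
          (fun p : ℕ => (p : ℝ) < (y * Real.exp (-((kf q : ℝ) * (Real.log (y / w) / (K : ℝ)))))), 4 * X * ((p : ℝ)⁻¹ * (q : ℝ)⁻¹) := by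
          refine Finset.sum_le_sum fun p hp => ?_
          simp only [Finset.mem_filter, mem_primesIco] at hp
          exact norm_siftedQ_two_primes_le hc hx1 hp.1.1.1 hqp _
      _ = 4 * X * (q : ℝ)⁻¹ * ∑ p ∈ ((primesIco w z).filter (fun p : ℕ => q < p)).filter
          (fun p : ℕ => (p : ℝ) < (y * Real.exp (-((kf q : ℝ) * (Real.log (y / w) / (K : ℝ)))))), (p : ℝ)⁻¹ := by
          rw [Finset.mul_sum]; refine Finset.sum_congr rfl fun p _ => by ring
      _ ≤ 4 * X * (q : ℝ)⁻¹ * Δ₀ := mul_le_mul_of_nonneg_left hshort (by positivity)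
      _ = 4 * X * Δ₀ * (q : ℝ)⁻¹ := by ring
  have hAsum : ‖∑ q ∈ primesIco w y, A q‖ ≤ 4 * X * Δ₀ * G := by
    refine (norm_sum_le _ _).trans ((Finset.sum_le_sum hAq).trans ?_)
    rw [← Finset.mul_sum]
    refine mul_le_mul_of_nonneg_left (hGbound _ fun q hq => ?_) (by positivity)
    obtain ⟨hqp, -, hqy⟩ := mem_primesIco.1 hq
    exact ⟨hqp, by linarith⟩
  -- (C)
  have hCq : ∀ q ∈ primesIco w y, ‖C q‖ ≤ 8 * X * G * Δ₀ * (q : ℝ)⁻¹ := by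
    intro q hq
    obtain ⟨hk, hq1, hq2⟩ := hkf q hq
    obtain ⟨hqp, hwq, hqy⟩ := mem_primesIco.1 hq
    rw [hC]
    dsimp only
    refine (norm_sum_le _ _).trans ?_
    have hinner : ∀ p ∈ primesIco ((y * Real.exp (-((kf q : ℝ) * (Real.log (y / w) / (K : ℝ)))))) z,
        ‖∑ r ∈ primesIco q ((y * Real.exp (-((kf q : ℝ) * (Real.log (y / w) / (K : ℝ)))))), siftedQ c x (p * q * r) r‖ ≤
          8 * X * (q : ℝ)⁻¹ * Δ₀ * (p : ℝ)⁻¹ := by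
      intro p hp
      obtain ⟨hpp, -, -⟩ := mem_primesIco.1 hp
      refine (norm_sum_le _ _).trans ?_
      have hshort : ∑ r ∈ primesIco q ((y * Real.exp (-((kf q : ℝ) * (Real.log (y / w) / (K : ℝ)))))), (r : ℝ)⁻¹ ≤ Δ₀ := by
        refine sum_inv_short_le hw1 hwy.le hK hk fun r hr => ?_
        obtain ⟨-, hqr, hru⟩ := mem_primesIco.1 hr
        exact ⟨hq1.trans hqr, hru⟩
      calc ∑ r ∈ primesIco q ((y * Real.exp (-((kf q : ℝ) * (Real.log (y / w) / (K : ℝ)))))), ‖siftedQ c x (p * q * r) r‖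
          ≤ ∑ r ∈ primesIco q ((y * Real.exp (-((kf q : ℝ) * (Real.log (y / w) / (K : ℝ)))))), 8 * X * ((p : ℝ)⁻¹ * (q : ℝ)⁻¹ * (r : ℝ)⁻¹) := by
            refine Finset.sum_le_sum fun r hr => ?_
            exact norm_siftedQ_three_primes_le hc hx1 hpp hqp (mem_primesIco.1 hr).1 _
        _ = 8 * X * (q : ℝ)⁻¹ * (p : ℝ)⁻¹ * ∑ r ∈ primesIco q ((y * Real.exp (-((kf q : ℝ) * (Real.log (y / w) / (K : ℝ)))))), (r : ℝ)⁻¹ := by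
            rw [Finset.mul_sum]; refine Finset.sum_congr rfl fun r _ => by ring
        _ ≤ 8 * X * (q : ℝ)⁻¹ * (p : ℝ)⁻¹ * Δ₀ := mul_le_mul_of_nonneg_left hshort (by positivity)
        _ = 8 * X * (q : ℝ)⁻¹ * Δ₀ * (p : ℝ)⁻¹ := by ring
    refine (Finset.sum_le_sum hinner).trans ?_
    rw [← Finset.mul_sum]
    have hpsum : ∑ p ∈ primesIco ((y * Real.exp (-((kf q : ℝ) * (Real.log (y / w) / (K : ℝ)))))) z, (p : ℝ)⁻¹ ≤ G := by
      refine hGbound _ fun p hp => ?_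
      obtain ⟨hpp, -, hpz⟩ := mem_primesIco.1 hp
      exact ⟨hpp, by linarith⟩
    calc 8 * X * (q : ℝ)⁻¹ * Δ₀ * ∑ p ∈ primesIco ((y * Real.exp (-((kf q : ℝ) * (Real.log (y / w) / (K : ℝ)))))) z, (p : ℝ)⁻¹
        ≤ 8 * X * (q : ℝ)⁻¹ * Δ₀ * G := mul_le_mul_of_nonneg_left hpsum (by positivity)
      _ = 8 * X * G * Δ₀ * (q : ℝ)⁻¹ := by ring
  have hCsum : ‖∑ q ∈ primesIco w y, C q‖ ≤ 8 * X * G * Δ₀ * G := by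
    refine (norm_sum_le _ _).trans ((Finset.sum_le_sum hCq).trans ?_)
    rw [← Finset.mul_sum]
    refine mul_le_mul_of_nonneg_left (hGbound _ fun q hq => ?_) (by positivity)
    obtain ⟨hqp, -, hqy⟩ := mem_primesIco.1 hq
    exact ⟨hqp, by linarith⟩
  -- (B): regroup by `k` and apply (35) to each fibre
  have hBsum : ‖∑ q ∈ primesIco w y, B q‖ ≤ K * B₂ := by
    have hmaps : ∀ q ∈ primesIco w y, kf q ∈ Finset.range K :=
      fun q hq => Finset.mem_range.2 (hkf q hq).1
    rw [← Finset.sum_fiberwise_of_maps_to hmaps]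
    refine (norm_sum_le _ _).trans ?_
    have hfib : ∀ k ∈ Finset.range K,
        ‖∑ q ∈ (primesIco w y).filter (fun q : ℕ => kf q = k), B q‖ ≤ B₂ := by
      intro k _
      have hQ : ∀ q ∈ (primesIco w y).filter (fun q : ℕ => kf q = k),
          q.Prime ∧ w ≤ (q : ℝ) ∧ (q : ℝ) < y ∧ (q : ℝ) < (y * Real.exp (-((k : ℝ) * (Real.log (y / w) / (K : ℝ))))) := by
        intro q hq
        rw [Finset.mem_filter] at hq
        obtain ⟨hqp, hwq, hqy⟩ := mem_primesIco.1 hq.1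
        have h := (hkf q hq.1).2.2
        rw [hq.2] at h
        exact ⟨hqp, hwq, hqy, h⟩
      obtain ⟨α, β, hα, hβ, hβp, hid⟩ :=
        exists_sieveR₂_eq c (z := z) (hyz.trans hzx) hQ
      have hrw : ∑ q ∈ (primesIco w y).filter (fun q : ℕ => kf q = k), B q =
          ∑ q ∈ (primesIco w y).filter (fun q : ℕ => kf q = k),
            ∑ p ∈ primesIco ((y * Real.exp (-((k : ℝ) * (Real.log (y / w) / (K : ℝ)))))) z, siftedQ c x (p * q) ((y * Real.exp (-((k : ℝ) * (Real.log (y / w) / (K : ℝ)))))) := by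
        refine Finset.sum_congr rfl fun q hq => ?_
        rw [Finset.mem_filter] at hq
        rw [hBdef]
        dsimp only
        rw [hq.2]
      rw [hrw, ← hid]
      exact hB α β hα hβ hβp
    calc ∑ k ∈ Finset.range K, ‖∑ q ∈ (primesIco w y).filter (fun q : ℕ => kf q = k), B q‖
        ≤ ∑ k ∈ Finset.range K, B₂ := Finset.sum_le_sum hfib
      _ = K * B₂ := by rw [Finset.sum_const, Finset.card_range, nsmul_eq_mul]
  -- assemble
  calc ‖∑ q ∈ primesIco w y, A q + ∑ q ∈ primesIco w y, B q + ∑ q ∈ primesIco w y, C q‖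
      ≤ ‖∑ q ∈ primesIco w y, A q‖ + ‖∑ q ∈ primesIco w y, B q‖ + ‖∑ q ∈ primesIco w y, C q‖ :=
        norm_add₃_le
    _ ≤ 4 * X * Δ₀ * G + K * B₂ + 8 * X * G * Δ₀ * G := by linarith
    _ = X * Δ₀ * G * (4 + 8 * G) + K * B₂ := by ring

/-- The same with the whole double sum: `|∑_{w≤q<z} ∑_{q<p<z} S(C_{pq}, q) − ∑_{y≤q<z} ∑_{q<p<z} S(C_{pq}, q)|
≤ X Δ₀ G (4 + 8G) + K B₂`. [cite: DukeFriedlanderIwaniec1995, §6 Lemma 2 (31)] -/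
theorem norm_doubleSum_sub_le {c : ℕ → ℂ} (hc : ∀ n : ℕ, 1 ≤ n → ‖c n‖ ≤ (Nat.divisors n).card)
    {x w y z : ℝ} {K : ℕ} (hw : 2 ≤ w) (hwy : w < y) (hyz : y ≤ z) (hzx : z ≤ x) (hK : 0 < K) {B₂ : ℝ}
    (hB : ∀ α β : ℕ → ℂ, (∀ m : ℕ, ‖α m‖ ≤ ArithmeticFunction.cardDistinctFactors m) →
      (∀ n : ℕ, ‖β n‖ ≤ 1) → (∀ n : ℕ, ¬ n.Prime → β n = 0) → ‖sieveR₂ c α β x w y‖ ≤ B₂) :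
    ‖∑ q ∈ primesIco w z, ∑ p ∈ (primesIco w z).filter (fun p : ℕ => q < p), siftedQ c x (p * q) q -
        ∑ q ∈ primesIco y z, ∑ p ∈ (primesIco w z).filter (fun p : ℕ => q < p), siftedQ c x (p * q) q‖ ≤
      (x * (1 + Real.log x)) * (w⁻¹ + Real.log (y / w) / K) * (Real.log (Real.log x) + 4) *
          (4 + 8 * (Real.log (Real.log x) + 4)) + K * B₂ := by
  rw [sum_primesIco_split hwy.le hyz, add_sub_cancel_right]
  exact norm_doubleSum_middle_le hc hw hwy hyz hzx hK hB

end

end DFI1995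

end Literature.NumberTheory.Sieve
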